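import Summits.BirchSwinnertonDyer.BirchSwinnertonDyer.Theorems.EdixhovenFibreFiveSevenNonEisensteinWitnessCore
import Literature.NumberTheory.EllipticCurves.SupersingularDensitySerreTraceProofs
import HarnessLib

/-!
# The auxiliary prime of ROAD A′ (Ihara-free L-TWIST), III-a: frames of `E[p]` — PROVED

Cell `pub/bsd-wall`, seat `bsd-wall-manin-p1` (prover, explicit-unit on AKR crux #7
stmt-BirchSwinnertonDyer-20709 `ManinFrameResidueProperR`, line `tame_twist`; serves equally the sibling line
`route-BirchSwinnertonDyer-EdixhovenFibreFiveSeven`). THEOREMS ONLY (no definition, no named fact, no `sorry`);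
route-free. BSD is not proved by this file.

Three frame lemmas on the `𝔽_p`-plane `E[p] = W.geomTorsion p` used by the sibling `…AuxPrime.lean`
(the auxiliary prime of the Ihara-free L-TWIST by Chebotarev):
* `exists_frame_of_eigenvectors` — a frame `e : E[p] ≃ (ℤ/p)²` through the two eigenvectors of an involution
  (complex conjugation; `RatClosure.exists_eigenvectors`), `p` odd;
* `exists_mulVec_ne_smul` — `E[p]` irreducible (`HasIrreducibleModPGaloisRep`) ⟹ no common eigenvector of the
  matrices of `Γ_ℚ` in a frame;
* `trace_frame_eq` — the trace of `σ` on `E[p]` (as in Serre's (238), tree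
  `trace_galoisRepTorsion_frobenius_eq`) is the trace of its matrix in any frame.

Axioms: `propext`, `Classical.choice`, `Quot.sound`.

References: [SilvermanAEC2009] III.§7, Cor. III.6.4(b) (`E[p] ≅ (ℤ/p)²`); [Serre1981] §8.1 (238).
-/

set_option autoImplicit false
-- the Theorems directory repeats the summit name (sibling precedent `SignedBaseChangeAssembly.lean`)
set_option linter.dupNamespace false

noncomputable section

open scoped Classical

open WeierstrassCurve NumberField IsDedekindDomain Field
  Literature.NumberTheory.EllipticCurves Literature.NumberTheory.GaloisRepresentations

namespace Summit.BirchSwinnertonDyer.BirchSwinnertonDyer.Theorems.AuxPrime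

/-! ### §1 The frame of the eigenvectors of complex conjugation; eigenlines; the trace in a frame -/

/-- **A frame through the two eigenvectors of an involution**: for `p` odd and `v₊, v₋ ∈ E[p] ∖ {O}` with
`c v₊ = v₊`, `c v₋ = −v₋` there is `e : E[p] ≃ (ℤ/p)²` with `e v₊ = (1,0)`, `e v₋ = (0,1)` (`v₊, v₋` are
linearly independent: apply `c` to a relation; `#E[p] = p²`). [folklore] -/
theorem exists_frame_of_eigenvectors (W : WeierstrassCurve ℚ) [W.IsElliptic] (p : ℕ) [Fact p.Prime]
    (hp2 : p ≠ 2) {c : absoluteGaloisGroup ℚ} {vp vm : geomTorsion W p} (hvp0 : vp ≠ 0)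
    (hvp : c • vp = vp) (hvm0 : vm ≠ 0) (hvm : c • vm = -vm) :
    ∃ e : geomTorsion W p ≃+ (Fin 2 → ZMod p), e vp = Pi.single 0 1 ∧ e vm = Pi.single 1 1 := by
  letI : Module (ZMod p) (geomTorsion W p) := AddSubgroup.torsionBy.zmodModule
  have hp : p.Prime := Fact.out
  haveI : NeZero p := ⟨hp.ne_zero⟩
  haveI : NeZero (p : ℚ) := NeZero.charZero
  haveI : Finite (geomTorsion W p) :=
    Nat.finite_of_card_ne_zero (by rw [natCard_geomTorsion W p]; exact pow_ne_zero 2 hp.ne_zero)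
  haveI : Module.Finite (ZMod p) (geomTorsion W p) := Module.Finite.of_finite
  have hrank : Module.finrank (ZMod p) (geomTorsion W p) = 2 := by
    have h := Module.natCard_eq_pow_finrank (K := ZMod p) (V := geomTorsion W p)
    rw [natCard_geomTorsion W p, Nat.card_zmod] at h
    exact (Nat.pow_right_injective hp.two_le h).symm
  have h2 : (2 : ZMod p) ≠ 0 := by
    intro h
    have h' : ((2 : ℕ) : ZMod p) = 0 := by rw [Nat.cast_ofNat]; exact h
    rw [ZMod.natCast_eq_zero_iff] at h'
    exact hp2 ((Nat.prime_dvd_prime_iff_eq hp Nat.prime_two).mp h')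
  have hcs : ∀ (s : ZMod p) (P : geomTorsion W p), c • (s • P) = s • (c • P) := fun s P ↦
    ZMod.map_smul (DistribSMul.toAddMonoidHom (geomTorsion W p) c) s P
  have hli : LinearIndependent (ZMod p) ![vp, vm] := by
    rw [LinearIndependent.pair_iff]
    intro s t hst
    have hst' : s • vp - t • vm = 0 := by
      have h := congrArg (fun P : geomTorsion W p ↦ c • P) hst
      simp only [smul_add, hcs, hvp, hvm, smul_neg, smul_zero] at h
      rw [← sub_eq_add_neg] at h
      exact h
    have hs2 : (2 * s) • vp = 0 := by
      rw [mul_smul, two_smul]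
      have := congrArg₂ (· + ·) hst hst'
      simp only [add_zero] at this
      rw [← this]
      abel
    have hs : s = 0 := by
      rcases smul_eq_zero.mp hs2 with h | h
      · exact (mul_eq_zero.mp h).resolve_left h2
      · exact absurd h hvp0
    rw [hs, zero_smul, zero_add] at hst
    exact ⟨hs, (smul_eq_zero.mp hst).resolve_right hvm0⟩
  let b : Module.Basis (Fin 2) (ZMod p) (geomTorsion W p) :=
    basisOfLinearIndependentOfCardEqFinrank hli (by rw [hrank, Fintype.card_fin])
  have hb : ∀ i, b i = ![vp, vm] i := fun i ↦ by
    change (basisOfLinearIndependentOfCardEqFinrank hli _) i = _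
    rw [coe_basisOfLinearIndependentOfCardEqFinrank]
  refine ⟨b.equivFun.toAddEquiv, ?_, ?_⟩
  · change b.equivFun vp = _
    have : vp = b 0 := by rw [hb]; rfl
    rw [this]
    funext j
    rw [Module.Basis.equivFun_self, Pi.single_apply]
    simp only [eq_comm]
  · change b.equivFun vm = _
    have : vm = b 1 := by rw [hb]; rfl
    rw [this]
    funext j
    rw [Module.Basis.equivFun_self, Pi.single_apply]
    simp only [eq_comm]

/-- **No common eigenvector** for an irreducible `E[p]`: in any frame `e` with matrices `M σ`
(`e (σ P) = M σ · e P`), every non-zero `v ∈ 𝔽_p²` is moved off its line by some `M σ` (the preimage of the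
line `𝔽_p v` would be a proper non-zero `Γ_ℚ`-stable subgroup). [folklore] -/
theorem exists_mulVec_ne_smul (W : WeierstrassCurve ℚ) [W.IsElliptic] (p : ℕ) [Fact p.Prime]
    (hirr : W.HasIrreducibleModPGaloisRep p) (e : geomTorsion W p ≃+ (Fin 2 → ZMod p))
    (M : absoluteGaloisGroup ℚ → Matrix (Fin 2) (Fin 2) (ZMod p))
    (hM : ∀ (σ : absoluteGaloisGroup ℚ) (T : geomTorsion W p), e (σ • T) = (M σ).mulVec (e T))
    (v : Fin 2 → ZMod p) (hv : v ≠ 0) :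
    ∃ σ : absoluteGaloisGroup ℚ, ∀ a : ZMod p, (M σ).mulVec v ≠ a • v := by
  by_contra h
  push Not at h
  let H : AddSubgroup (geomTorsion W p) :=
    { carrier := {T | ∃ a : ZMod p, e T = a • v}
      add_mem' := by
        rintro T₁ T₂ ⟨a₁, ha₁⟩ ⟨a₂, ha₂⟩
        exact ⟨a₁ + a₂, by rw [map_add, ha₁, ha₂, add_smul]⟩
      zero_mem' := ⟨0, by rw [map_zero, zero_smul]⟩
      neg_mem' := by
        rintro T ⟨a, ha⟩
        exact ⟨-a, by rw [map_neg, ha, neg_smul]⟩ }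
  have hHmem : ∀ T, T ∈ H ↔ ∃ a : ZMod p, e T = a • v := fun T ↦ Iff.rfl
  have hstab : ∀ σ : absoluteGaloisGroup ℚ, ∀ T ∈ H, σ • T ∈ H := by
    intro σ T hT
    obtain ⟨a, ha⟩ := (hHmem T).mp hT
    obtain ⟨aσ, haσ⟩ := h σ
    exact (hHmem _).mpr ⟨aσ * a, by rw [hM, ha, Matrix.mulVec_smul, haσ, smul_smul, mul_comm]⟩
  rcases hirr H hstab with hbot | htop
  · have hmem : e.symm v ∈ H := (hHmem _).mpr ⟨1, by rw [e.apply_symm_apply, one_smul]⟩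
    rw [hbot, AddSubgroup.mem_bot] at hmem
    apply hv
    rw [← e.apply_symm_apply v, hmem, map_zero]
  · have hall : ∀ w : Fin 2 → ZMod p, ∃ a : ZMod p, w = a • v := fun w ↦ by
      have hw : e.symm w ∈ H := by rw [htop]; exact AddSubgroup.mem_top _
      obtain ⟨a, ha⟩ := (hHmem _).mp hw
      exact ⟨a, by rw [← ha, e.apply_symm_apply]⟩
    by_cases hv0 : v 0 = 0
    · have hv1 : v 1 ≠ 0 := by
        intro hv1
        apply hv
        funext i
        fin_cases i
        · exact hv0
        · exact hv1
      obtain ⟨a, ha⟩ := hall (Pi.single 0 1)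
      have h1 := congrFun ha 1
      have h0 := congrFun ha 0
      simp only [Pi.smul_apply, smul_eq_mul, hv0, mul_zero, Pi.single_eq_same] at h0
      exact one_ne_zero h0
    · obtain ⟨a, ha⟩ := hall (Pi.single 1 1)
      have h0 := congrFun ha 0
      have h1 := congrFun ha 1
      simp only [Pi.smul_apply, smul_eq_mul, ne_eq, not_false_eq_true, Pi.single_eq_of_ne,
        zero_ne_one] at h0
      have ha0 : a = 0 := (mul_eq_zero.mp h0.symm).resolve_right hv0
      simp only [Pi.smul_apply, smul_eq_mul, ha0, zero_mul, Pi.single_eq_same] at h1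
      exact one_ne_zero h1

/-- **The trace in a frame**: if `e (σ P) = M · e P` on `E[p]`, the trace of `σ` on the `𝔽_p`-plane `E[p]`
(as in `trace_galoisRepTorsion_frobenius_eq`) is `tr M`. [folklore] -/
theorem trace_frame_eq (W : WeierstrassCurve ℚ) [W.IsElliptic] (p : ℕ) [Fact p.Prime]
    (e : geomTorsion W p ≃+ (Fin 2 → ZMod p)) (σ : absoluteGaloisGroup ℚ)
    (M : Matrix (Fin 2) (Fin 2) (ZMod p)) (hM : ∀ T : geomTorsion W p, e (σ • T) = M.mulVec (e T)) :
    letI : Module (ZMod p) (geomTorsion W p) := AddSubgroup.torsionBy.zmodModule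
    LinearMap.trace (ZMod p) (geomTorsion W p)
        ((galoisRepTorsion W p σ).toAdd.toAddMonoidHom.toZModLinearMap p) = M.trace := by
  letI : Module (ZMod p) (geomTorsion W p) := AddSubgroup.torsionBy.zmodModule
  let e' : geomTorsion W p ≃ₗ[ZMod p] (Fin 2 → ZMod p) :=
    { e with map_smul' := fun c x ↦ ZMod.map_smul e c x }
  set f := (galoisRepTorsion W p σ).toAdd.toAddMonoidHom.toZModLinearMap p with hfdef
  have hf : ∀ Q : geomTorsion W p, f Q = σ • Q := fun Q ↦ rfl
  have hconj : e'.conj f = Matrix.toLin' M := by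
    apply LinearMap.ext
    intro w
    rw [LinearEquiv.conj_apply_apply, Matrix.toLin'_apply]
    change e (f (e.symm w)) = M.mulVec w
    rw [hf, hM, e.apply_symm_apply]
  rw [← LinearMap.trace_conj' f e', hconj, Matrix.trace_toLin'_eq]

end Summit.BirchSwinnertonDyer.BirchSwinnertonDyer.Theorems.AuxPrime

end
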